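import Mathlib
import Summits.Ventures.DiscreteObjects.Mahler.LowDegreeCensus
import Summits.Ventures.DiscreteObjects.Mahler.PisotLowerBound

/-!
# Tools for the degree-4 census row (venture `DiscreteObjects`, target L)

Cell `pub-namedobj`, seat `pub-namedobj-mahler` (gen 10). Framing: lottery ticket; floor = certified
bounds/negative ranges.

Lemmas used by `PalindromicQuartic` / `QuarticCensus` (`DegreeCensus 4 1.3248 []`):
(the distinctness of the complex roots of an irreducible integer polynomial is `nodup_roots_of_irreducible`,
gen 8, `PisotLowerBound`);
* `root_ne_inv_of_irreducible` — a root `β` of an irreducible `P` of degree `≥ 2` has `β ≠ 0`, `β ≠ β⁻¹`;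
* `norm_prod_sub_le_two_pow` — `|∏_T (ε - β)| ≤ 2^{|T|}` for `|ε| = 1`, `T` in the closed unit disc;
* `palindromic_quartic_eq` — a monic palindromic quartic is `x⁴ + ax³ + bx² + ax + 1`;
* `trace_root_quadratic` — `y = α + α⁻¹` satisfies `y² + ay + (b-2) = 0`;
* `im_sq_ge_of_int_quadratic` — a non-real root `y` of `y² + ay + c` (`a, c ∈ ℤ`) has `Im(y)² ≥ 3/4`
  (`4 Im(y)² = 4c - a²` is a positive integer `≡ 0, 3 (mod 4)`).
-/

namespace Summit.Ventures.DiscreteObjects.Mahler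

open Polynomial
open scoped ComplexConjugate

/-! ### Tools -/

/-- A root `β` of an irreducible `P ∈ ℤ[X]` of degree `≥ 2` satisfies `β ≠ β⁻¹` and `β ≠ 0`. -/
theorem root_ne_inv_of_irreducible {P : ℤ[X]} (hirr : Irreducible P) (hdeg : 2 ≤ P.natDegree) {β : ℂ}
    (hβ : β ∈ (P.map (Int.castRingHom ℂ)).roots) : β ≠ 0 ∧ β ≠ β⁻¹ := by
  have hP' : P.map (Int.castRingHom ℂ) ≠ 0 :=
    (Polynomial.map_ne_zero_iff (Int.castRingHom ℂ).injective_int).mpr hirr.ne_zero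
  have hroot : aeval β P = 0 := by
    have := (mem_roots hP').mp hβ
    rwa [IsRoot.def, ← algebraMap_int_eq, eval_map_algebraMap] at this
  have key : ∀ t : ℤ, P.eval t ≠ 0 := by
    intro t ht
    have hdvd : X - C t ∣ P := dvd_iff_isRoot.mpr ht
    have hass : Associated (X - C t) P := (irreducible_X_sub_C t).associated_of_dvd hirr hdvd
    have h1 := natDegree_eq_of_degree_eq (degree_eq_degree_of_associated hass)
    rw [natDegree_X_sub_C] at h1
    omega
  have hint : ∀ t : ℤ, β = (t : ℂ) → False := by
    intro t ht
    apply key t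
    have h2 : (algebraMap ℤ ℂ) (P.eval t) = 0 := by
      rw [← aeval_algebraMap_apply_eq_algebraMap_eval, algebraMap_int_eq, eq_intCast, ← ht]
      exact hroot
    rw [algebraMap_int_eq, eq_intCast, Int.cast_eq_zero] at h2
    exact h2
  have hβ0 : β ≠ 0 := fun h0 => hint 0 (by rw [h0]; simp)
  constructor
  · exact hβ0
  · intro h
    have h2 : β * β = 1 := by
      conv_lhs => rhs
                  rw [h]
      exact mul_inv_cancel₀ hβ0
    rcases mul_self_eq_one_iff.mp h2 with h1 | h1
    · exact hint 1 (by rw [h1]; simp)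
    · exact hint (-1) (by rw [h1]; simp)

/-- `|∏_{T} (ε - β)| ≤ 2^{|T|}` when `|ε| = 1` and all `β ∈ T` lie in the closed unit disc. -/
theorem norm_prod_sub_le_two_pow (T : Multiset ℂ) (ε : ℂ) (hε : ‖ε‖ = 1) (hT : ∀ β ∈ T, ‖β‖ ≤ 1) :
    ‖(T.map fun β => ε - β).prod‖ ≤ 2 ^ Multiset.card T := by
  rw [← normHom_apply, map_multiset_prod, Multiset.map_map]
  have h : (T.map (⇑normHom ∘ fun β => ε - β)).prod ≤ (T.map fun _ => (2 : ℝ)).prod := by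
    refine Multiset.prod_map_le_prod_map₀ _ _ (fun β _ => by simp) (fun β hβ => ?_)
    simp only [Function.comp_apply, normHom_apply]
    calc ‖ε - β‖ ≤ ‖ε‖ + ‖β‖ := norm_sub_le _ _
      _ ≤ 1 + 1 := add_le_add hε.le (hT β hβ)
      _ = 2 := by norm_num
  rwa [Multiset.map_const', Multiset.prod_replicate] at h

/-! ### The reciprocal (palindromic) monic quartic -/

/-- Coefficient form of a monic palindromic quartic. -/
theorem palindromic_quartic_eq {m : ℤ[X]} (hdeg : m.natDegree = 4) (hmonic : m.Monic) (hrev : m.reverse = m) :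
    m = X ^ 4 + C (m.coeff 3) * X ^ 3 + C (m.coeff 2) * X ^ 2 + C (m.coeff 3) * X + 1 := by
  have hc4 : m.coeff 4 = 1 := by rw [← hdeg]; exact hmonic
  have hc0 : m.coeff 0 = 1 := by
    conv_lhs => rw [← hrev]
    rw [coeff_zero_reverse]; exact hmonic
  have hc1 : m.coeff 1 = m.coeff 3 := by
    conv_lhs => rw [← hrev, coeff_reverse, hdeg, show revAt 4 1 = 3 by decide]
  have h := m.as_sum_range_C_mul_X_pow
  rw [hdeg] at h
  conv_lhs => rw [h]
  simp only [Finset.sum_range_succ, Finset.sum_range_zero, zero_add, pow_zero, mul_one, pow_one]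
  rw [hc0, hc1, hc4, map_one, one_mul]
  ring

/-- The trace relation: for a root `α ≠ 0` of `x⁴ + ax³ + bx² + ax + 1`, `y = α + α⁻¹` satisfies
`y² + ay + (b - 2) = 0`. -/
theorem trace_root_quadratic {a b : ℂ} {α : ℂ} (hα : α ≠ 0)
    (h : α ^ 4 + a * α ^ 3 + b * α ^ 2 + a * α + 1 = 0) :
    (α + α⁻¹) ^ 2 + a * (α + α⁻¹) + (b - 2) = 0 := by
  have h2 : α ^ 2 ≠ 0 := pow_ne_zero 2 hα
  have : (α + α⁻¹) ^ 2 + a * (α + α⁻¹) + (b - 2) = (α ^ 4 + a * α ^ 3 + b * α ^ 2 + a * α + 1) / α ^ 2 := by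
    field_simp
    ring
  rw [this, h, zero_div]

/-- If `y` is a non-real root of `y² + ay + c` with `a, c ∈ ℤ`, then `4 (Im y)² = 4c - a² ≥ 3`, hence
`(Im y)² ≥ 3/4`. -/
theorem im_sq_ge_of_int_quadratic {a c : ℤ} {y : ℂ} (h : y ^ 2 + (a : ℂ) * y + (c : ℂ) = 0) (hy : y.im ≠ 0) :
    (3 : ℝ) / 4 ≤ y.im ^ 2 := by
  -- real and imaginary parts
  have hre : y.re ^ 2 - y.im ^ 2 + a * y.re + c = 0 := by
    have := congrArg Complex.re h
    simp [pow_two] at this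
    linarith [this]
  have him : 2 * y.re * y.im + a * y.im = 0 := by
    have := congrArg Complex.im h
    simp [pow_two] at this
    linarith [this]
  have hre' : y.re = -(a : ℝ) / 2 := by
    have : y.im * (2 * y.re + a) = 0 := by linear_combination him
    rcases mul_eq_zero.mp this with h1 | h1
    · exact absurd h1 hy
    · linarith
  have hN : 4 * y.im ^ 2 = (4 * c - a ^ 2 : ℤ) := by
    push_cast
    rw [hre'] at hre
    linear_combination -4 * hre
  -- `N = 4c - a²` is a positive integer `≡ 0, 3 (mod 4)`, hence `≥ 3`
  have hNpos : 0 < 4 * c - a ^ 2 := by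
    have : (0 : ℝ) < 4 * y.im ^ 2 := by positivity
    rw [hN] at this
    exact_mod_cast this
  have hN3 : 3 ≤ 4 * c - a ^ 2 := by
    rcases Int.even_or_odd a with ⟨t, ht⟩ | ⟨t, ht⟩
    · subst ht
      have h4 : 4 * c - (t + t) ^ 2 = 4 * (c - t ^ 2) := by ring
      rw [h4] at hNpos ⊢
      omega
    · subst ht
      have h4 : 4 * c - (2 * t + 1) ^ 2 = 4 * (c - t ^ 2 - t) - 1 := by ring
      rw [h4] at hNpos ⊢
      omega
  have : (3 : ℝ) ≤ 4 * y.im ^ 2 := by rw [hN]; exact_mod_cast hN3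
  linarith

end Summit.Ventures.DiscreteObjects.Mahler
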